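import Summits.AtomisticToContinuum.Crystallization.Theorems.OverbindingBudgetAffineCompressedCutKernel

/-!
# Overbinding budget — compressed cut: kernel tables I (fcc growth `KF`, in-layer growth `E1`)

Kernel-computed tables (`decide +kernel`) for the exact adjacency kernel of
`OverbindingBudgetAffineCompressedCutKernel` (read through `kernelOneB_sound`):

* `kf_fcc` — an fcc parent `F⁺ = fccModelInt` and an fcc child along ANY of the twelve bonds: the child's
  pattern pulls back onto the SAME copy `F⁺` (fcc clusters are exactly coherent: Step A of layer rigidity);
* `kf_hcp` — an fcc parent and an hcp child: the child's pattern pulls back onto one of the EIGHT copies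
  `hcpFamilyL` (sign flips of `H`, `H′`), i.e. an hcp copy whose basal normal is a `(±1,±1,±1)` direction
  making the bond polar — this names the seed layer normal `n₀`;
* `e1_table` — an hcp parent (`H` or `H′`) and a child along a BASAL bond: an fcc child is impossible
  (empty family) and an hcp child carries the same copy (layers are type-uniform and grow exactly in-plane).

Single parent, registration of the parent's points adjacent to the child only.  Enumeration replayed in
pure integer arithmetic: cell `decomp-a2c`, `decomp-a2c-lens-4/g80/numerics/kernels.py` (same conclusions over
ALL tetrahedral frames, not only `tetraPick`).  No `sorry`, no new axioms.
-/

namespace Summit.AtomisticToContinuum.Crystallization.Theorems.OverbindingBudgetAffineCompressedCutKernel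

/-- The twelve first-shell points of `F⁺`. [this file] -/
def fccShellL : List T3 := fccL.filter fun v => tsq v == 18

/-- **KF (fcc child).**  Parent `F⁺`, child fcc along any bond: pull-back `= F⁺`. [this file, by `decide +kernel`] -/
theorem kf_fcc : kernelOneB fccL fccShellL fccL [fccL] = true := by
  decide +kernel

/-- **KF (hcp child).**  Parent `F⁺`, child hcp along any bond: pull-back is one of the eight copies `hcpFamilyL`.
[this file, by `decide +kernel`] -/
theorem kf_hcp : kernelOneB fccL fccShellL hcpL hcpFamilyL = true := by
  decide +kernel

/-- **E1 (in-layer growth).**  Parent `H` or `H′`, child along a basal bond: no fcc child; an hcp child carries the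
parent's copy. [this file, by `decide +kernel`] -/
theorem e1_table :
    (kernelOneB hcpL hexL fccL [] && kernelOneB hcpL hexL hcpL [hcpL] &&
      kernelOneB hcpAltL hexL fccL [] && kernelOneB hcpAltL hexL hcpL [hcpAltL]) = true := by
  decide +kernel

/-- `E1` unpacked: the four entries. [this file] -/
theorem e1_entries :
    kernelOneB hcpL hexL fccL [] = true ∧ kernelOneB hcpL hexL hcpL [hcpL] = true ∧
      kernelOneB hcpAltL hexL fccL [] = true ∧ kernelOneB hcpAltL hexL hcpL [hcpAltL] = true := by
  have h := e1_table
  simp only [Bool.and_eq_true] at h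
  exact ⟨h.1.1.1, h.1.1.2, h.1.2, h.2⟩

/-- Reading of an EMPTY family: under the kernel's hypotheses the configuration is impossible. [this file] -/
theorem kernelOneB_empty {P xs S : List T3} (h : kernelOneB P xs S [] = true) {x : T3} (hx : x ∈ xs)
    {w₁ w₂ w₃ : T3} (hw₁ : w₁ ∈ S) (hw₂ : w₂ ∈ S) (hw₃ : w₃ ∈ S) (hu : UnitTriple w₁ w₂ w₃)
    (hreg : RegAt P S x (tneg x) (tsub (tetraPick P x).1 x) (tsub (tetraPick P x).2 x) w₁ w₂ w₃) : False := by
  obtain ⟨Q, hQ, -⟩ := (kernelOneB_sound h hx).2.2.2 hw₁ hw₂ hw₃ hu hreg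
  simp at hQ

end Summit.AtomisticToContinuum.Crystallization.Theorems.OverbindingBudgetAffineCompressedCutKernel
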